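import Literature.MathematicalPhysics.QuantumChemistry.SlaterCondonRules
import HarnessLib

/-!
# The Slater–Condon rules, II: the transition strings and the vanishing rules (1.4.7), (1.4.25)

Part II of the Slater–Condon rules of Helgaker–Jørgensen–Olsen (2000) §1.4.1–1.4.2 on the tree's
Jordan–Wigner Fock space (setting and notation: `SlaterCondonRules.lean`). Contents:

* the single- and double-replacement strings on ON vectors: `a†_a a_b |k⟩` (HJO (1.2.22)) and
  `a†_I a†_J a_L a_K |k⟩` ((1.2.5), (1.2.16) iterated), with their phase factors;
* the anticommutator `[a†_P, a_Q]_+ = δ_PQ` (1.2.29) on vectors and the resulting contractions;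
* the contracted diagonal elements behind HJO's case analyses: for `|k₂⟩ = a†_a a_b |k₁⟩` only
  `P = I, Q = J` contributes to `⟨k₂|a†_P a_Q|k₁⟩` (1.4.10)–(1.4.11) and only the four cases (1.4.34)
  to `⟨k₂|a†_P a†_R a_S a_Q|k₁⟩` (1.4.33)–(1.4.35); the analogous double contraction for two
  replacements;
* **(1.4.7)** `dGamma_apply_eq_zero_of`: `⟨k₂|f̂|k₁⟩ = 0` unless `|k₁⟩`, `|k₂⟩` have the same electron
  number and differ in at most one pair of occupation numbers; **(1.4.25)**
  `twoElectronOp_apply_eq_zero_of`: `⟨k₂|ĝ|k₁⟩ = 0` unless they differ in at most two pairs.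

Everything is PROVED (0 sorry); no definition, no named fact; helpers are `private`.

## References

* T. Helgaker, P. Jørgensen, J. Olsen, *Molecular Electronic-Structure Theory*, Wiley (2000), §1.2
  eqs. (1.2.3), (1.2.5), (1.2.16), (1.2.22), (1.2.29); §1.3.1 eq. (1.3.2); §1.4.1 eqs. (1.4.2)–(1.4.13);
  §1.4.2 eqs. (1.4.14)–(1.4.38); §1.4.3 eq. (1.4.39); held copy
  `book:helgakernd-molecular-electronic-structure-theory` (chunks p0039–p0042, p0045–p0049 read
  2026-08-21). [cite: HelgakerJorgensenOlsen2000, §1.4.1–1.4.2]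
* J. C. Slater, Phys. Rev. 34 (1929) 1293; E. U. Condon, Phys. Rev. 36 (1930) 1121 (the original
  rules; ref. [1] of HJO Ch. 1).
-/

noncomputable section

namespace Literature.MathematicalPhysics.QuantumChemistry

open Matrix Finset
open Literature.MathematicalPhysics.QuantumLattice

section SpinOrbital

variable {ι : Type*} [LinearOrder ι] [Fintype ι]

/-- `X_{IJ} = (X |J⟩)_I` for the ON vector `|J⟩ = e_J` (plumbing). [folklore] -/
private theorem apply_eq_mulVec_single (X : Matrix (Finset ι) (Finset ι) ℂ) (I J : Finset ι) :
    X I J = (X *ᵥ Pi.single J (1 : ℂ)) I := by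
  rw [mulVec_single_one, col_apply]

/-- `M a_u |T⟩ = 0` if `u ∉ T` (helper). [folklore] -/
private theorem mul_annihilation_mulVec_single_of_not_mem (M : Matrix (Finset ι) (Finset ι) ℂ) {u : ι}
    {T : Finset ι} (hu : u ∉ T) : (M * annihilation u) *ᵥ Pi.single T (1 : ℂ) = 0 := by
  rw [← mulVec_mulVec, annihilation_mulVec_single_of_not_mem hu, mulVec_zero]

/-- `M a_u a_z |J⟩ = 0` if `u ∉ J` (helper). [folklore] -/
private theorem mul_annihilation_annihilation_mulVec_single_of_not_mem (M : Matrix (Finset ι) (Finset ι) ℂ)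
    {u : ι} (z : ι) {J : Finset ι} (hu : u ∉ J) :
    (M * annihilation u * annihilation z) *ᵥ Pi.single J (1 : ℂ) = 0 := by
  rw [← mulVec_mulVec, annihilation_mulVec_single]
  split_ifs with hz
  · rw [mulVec_smul,
      mul_annihilation_mulVec_single_of_not_mem M (fun h => hu (mem_of_mem_erase h)), smul_zero]
  · rw [mulVec_zero]

/-- `M a_u a_y a_z |J⟩ = 0` if `u ∉ J` (helper). [folklore] -/
private theorem mul_annihilation_annihilation_annihilation_mulVec_single_of_not_mem
    (M : Matrix (Finset ι) (Finset ι) ℂ) {u : ι} (y z : ι) {J : Finset ι} (hu : u ∉ J) :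
    (M * annihilation u * annihilation y * annihilation z) *ᵥ Pi.single J (1 : ℂ) = 0 := by
  rw [← mulVec_mulVec, annihilation_mulVec_single]
  split_ifs with hz
  · rw [mulVec_smul, mul_annihilation_annihilation_mulVec_single_of_not_mem M y
      (fun h => hu (mem_of_mem_erase h)), smul_zero]
  · rw [mulVec_zero]

/-! ### The transition strings and the anticommutator on vectors -/

/-- **The single-replacement string**: for `b` occupied and `a` empty in `|k⟩ = |J⟩`,
`a†_a a_b |k⟩ = Γ_b^{k} Γ_a^{k∖b} |k ∖ b ∪ a⟩` — Helgaker–Jørgensen–Olsen (2000) eq. (1.2.22) (printed for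
`a > b`, where `Γ_a^{k∖b} = −Γ_a^{k}`; the product of the two phases met by the string covers both
orders). [cite: HelgakerJorgensenOlsen2000, eq. (1.2.22)] -/
theorem creation_mul_annihilation_mulVec_single_of_mem {a b : ι} {J : Finset ι} (hb : b ∈ J)
    (ha : a ∉ J) :
    (creation a * annihilation b) *ᵥ Pi.single J (1 : ℂ) =
      (jwSign b J * jwSign a (J.erase b)) • Pi.single (insert a (J.erase b)) 1 := by
  rw [← mulVec_mulVec, annihilation_mulVec_single, if_pos hb, mulVec_smul,
    FermionOperatorsProofs.creation_mulVec_single, if_neg (fun h => ha (mem_of_mem_erase h)),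
    smul_smul]

/-- **The double-replacement string**: for `K ≠ L` occupied and `I ≠ J` empty in `|k⟩ = |D⟩`,
`a†_I a†_J a_L a_K |k⟩ = ± |k ∖ {K, L} ∪ {I, J}⟩` with the product of the four phase factors met on
the way (`a_K` acts first), by (1.2.16) twice and (1.2.5) twice — Helgaker–Jørgensen–Olsen (2000)
eqs. (1.2.5), (1.2.16). [cite: HelgakerJorgensenOlsen2000, eqs. (1.2.5), (1.2.16)] -/
theorem doubleString_mulVec_single {I J K L : ι} {D : Finset ι} (hK : K ∈ D) (hL : L ∈ D)
    (hKL : K ≠ L) (hI : I ∉ D) (hJ : J ∉ D) (hIJ : I ≠ J) :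
    (creation I * creation J * annihilation L * annihilation K) *ᵥ Pi.single D (1 : ℂ) =
      (jwSign K D * jwSign L (D.erase K) * jwSign J ((D.erase K).erase L) *
          jwSign I (insert J ((D.erase K).erase L))) •
        Pi.single (insert I (insert J ((D.erase K).erase L))) 1 := by
  have hJT : J ∉ (D.erase K).erase L := fun h => hJ (mem_of_mem_erase (mem_of_mem_erase h))
  have hIT : I ∉ insert J ((D.erase K).erase L) := by
    rw [mem_insert, not_or]
    exact ⟨hIJ, fun h => hI (mem_of_mem_erase (mem_of_mem_erase h))⟩
  rw [← mulVec_mulVec, annihilation_mulVec_single, if_pos hK, mulVec_smul, ← mulVec_mulVec,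
    annihilation_mulVec_single, if_pos (mem_erase.2 ⟨hKL.symm, hL⟩), mulVec_smul, ← mulVec_mulVec,
    FermionOperatorsProofs.creation_mulVec_single, if_neg hJT, mulVec_smul,
    FermionOperatorsProofs.creation_mulVec_single, if_neg hIT, smul_smul, smul_smul, smul_smul]

/-- The anticommutator `[a†_P, a_Q]_+ = δ_{PQ}` — Helgaker–Jørgensen–Olsen (2000) eq. (1.2.29) —
applied to a vector: `a_a a†_P x = δ_{aP} x − a†_P a_a x`. [cite: HelgakerJorgensenOlsen2000, eq. (1.2.29)] -/
theorem annihilation_mulVec_creation_mulVec (a P : ι) (x : Fock ι) :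
    annihilation a *ᵥ (creation P *ᵥ x) =
      (if a = P then (1 : ℂ) else 0) • x - creation P *ᵥ (annihilation a *ᵥ x) := by
  rw [mulVec_mulVec, mulVec_mulVec, annihilation_mul_creation, sub_mulVec]
  by_cases h : a = P
  · rw [if_pos h, if_pos h, one_mulVec, one_smul]
  · rw [if_neg h, if_neg h, zero_mulVec, zero_smul]

/-- Moving one annihilator through two creators onto a vector it kills (twice (1.2.29)):
`a_a a†_P a†_R u = δ_{aP} a†_R u − δ_{aR} a†_P u` if `a_a u = 0` (helper). [folklore] -/
private theorem annihilation_mulVec_creation_creation_of_kills {a P R : ι} {u : Fock ι}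
    (hu : annihilation a *ᵥ u = 0) :
    annihilation a *ᵥ (creation P *ᵥ (creation R *ᵥ u)) =
      (if a = P then (1 : ℂ) else 0) • (creation R *ᵥ u) -
        (if a = R then (1 : ℂ) else 0) • (creation P *ᵥ u) := by
  rw [annihilation_mulVec_creation_mulVec, annihilation_mulVec_creation_mulVec, hu, mulVec_zero,
    sub_zero, mulVec_smul]

/-- Moving two annihilators through two creators onto a vector they kill (the double
contraction): `a_J a_I a†_P a†_R u = (δ_{IP} δ_{JR} − δ_{IR} δ_{JP}) u` if `a_I u = a_J u = 0` (helper).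
[folklore] -/
private theorem annihilation_annihilation_mulVec_creation_creation_of_kills {I J P R : ι} {u : Fock ι}
    (hI : annihilation I *ᵥ u = 0) (hJ : annihilation J *ᵥ u = 0) :
    annihilation J *ᵥ (annihilation I *ᵥ (creation P *ᵥ (creation R *ᵥ u))) =
      ((if I = P then (1 : ℂ) else 0) * (if J = R then (1 : ℂ) else 0) -
        (if I = R then (1 : ℂ) else 0) * (if J = P then (1 : ℂ) else 0)) • u := by
  rw [annihilation_mulVec_creation_creation_of_kills hI, mulVec_sub, mulVec_smul, mulVec_smul,
    annihilation_mulVec_creation_mulVec J R u, annihilation_mulVec_creation_mulVec J P u, hJ,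
    mulVec_zero, mulVec_zero, sub_zero, sub_zero, smul_smul, smul_smul, ← sub_smul]

/-! ### Contracted diagonal elements: one replacement ((1.4.11), (1.4.34)) and two replacements -/

section Single

variable {a b : ι} {J : Finset ι}

/-- For `b` occupied and `a` empty in `|k₁⟩ = |J⟩`: `⟨k₁| a†_b a_a (a†_P a_Q) |k₁⟩ = δ_{aP} δ_{bQ}` —
the transition element `⟨k₂| a†_P a_Q |k₁⟩` has a nonvanishing contribution only for `P = I (= a)`,
`Q = J (= b)`, Helgaker–Jørgensen–Olsen (2000) eqs. (1.4.10)–(1.4.11).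
[cite: HelgakerJorgensenOlsen2000, eqs. (1.4.10)–(1.4.11)] -/
theorem single_oneString_apply (hb : b ∈ J) (ha : a ∉ J) (P Q : ι) :
    (creation b * annihilation a * (creation P * annihilation Q)) J J =
      if a = P then (if b = Q then 1 else 0) else 0 := by
  have hu : annihilation a *ᵥ (annihilation Q *ᵥ Pi.single J (1 : ℂ)) = 0 := by
    rw [mulVec_mulVec, ← one_mul (annihilation a),
      mul_annihilation_annihilation_mulVec_single_of_not_mem 1 Q ha]
  rw [apply_eq_mulVec_single (creation b * annihilation a * (creation P * annihilation Q)) J J,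
    show creation b * annihilation a * (creation P * annihilation Q) =
      creation b * (annihilation a * (creation P * annihilation Q)) by simp only [mul_assoc],
    ← mulVec_mulVec, ← mulVec_mulVec, ← mulVec_mulVec, annihilation_mulVec_creation_mulVec, hu,
    mulVec_zero, sub_zero, mulVec_smul, Pi.smul_apply, mulVec_mulVec, ← apply_eq_mulVec_single,
    creation_mul_annihilation_apply_self, smul_eq_mul]
  by_cases hP : a = P
  · rw [if_pos hP, if_pos hP, one_mul]
    by_cases hQ : b = Q
    · rw [if_pos ⟨hQ, hQ ▸ hb⟩, if_pos hQ]
    · rw [if_neg (fun h => hQ h.1), if_neg hQ]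
  · rw [if_neg hP, if_neg hP, zero_mul]

/-- For `a` empty in `|k₁⟩ = |J⟩`:
`⟨k₁| a†_b a_a (a†_P a†_R a_S a_Q) |k₁⟩ = δ_{aP} ⟨k₁|a†_b a†_R a_S a_Q|k₁⟩ − δ_{aR} ⟨k₁|a†_b a†_P a_S a_Q|k₁⟩` —
the transition element `⟨k₂| a†_P a†_R a_S a_Q |k₁⟩` has nonvanishing contributions only in the four
cases `P = I` or `R = I` of Helgaker–Jørgensen–Olsen (2000) eqs. (1.4.33)–(1.4.35).
[cite: HelgakerJorgensenOlsen2000, eqs. (1.4.33)–(1.4.35)] -/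
theorem single_twoString_apply (ha : a ∉ J) (b P Q R S : ι) :
    (creation b * annihilation a * (creation P * creation R * annihilation S * annihilation Q)) J J =
      (if a = P then (1 : ℂ) else 0) * (creation b * creation R * annihilation S * annihilation Q) J J
        - (if a = R then (1 : ℂ) else 0) *
            (creation b * creation P * annihilation S * annihilation Q) J J := by
  have hu : annihilation a *ᵥ ((annihilation S * annihilation Q) *ᵥ Pi.single J (1 : ℂ)) = 0 := by
    rw [mulVec_mulVec, ← one_mul (annihilation a), ← mul_assoc,
      mul_annihilation_annihilation_annihilation_mulVec_single_of_not_mem 1 S Q ha]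
  rw [apply_eq_mulVec_single (creation b * annihilation a * _) J J,
    show creation b * annihilation a * (creation P * creation R * annihilation S * annihilation Q) =
      creation b * (annihilation a * (creation P * (creation R * (annihilation S * annihilation Q))))
      by simp only [mul_assoc],
    ← mulVec_mulVec, ← mulVec_mulVec, ← mulVec_mulVec, ← mulVec_mulVec,
    annihilation_mulVec_creation_creation_of_kills hu, mulVec_sub, mulVec_smul, mulVec_smul,
    Pi.sub_apply, Pi.smul_apply, Pi.smul_apply, smul_eq_mul, smul_eq_mul]
  simp only [mulVec_mulVec, ← mul_assoc, ← apply_eq_mulVec_single]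

end Single

section Double

variable {I J K L : ι} {D : Finset ι}

/-- `⟨D| a†_K a†_L a_J a_I (a†_P a_Q) |D⟩ = 0` for `I, J` empty in `|D⟩`: a one-electron operator cannot
connect ON vectors differing in two pairs (towards Helgaker–Jørgensen–Olsen (1.4.7); helper).
[folklore] -/
private theorem double_oneString_apply (hI : I ∉ D) (hJ : J ∉ D) (K L P Q : ι) :
    (creation K * creation L * annihilation J * annihilation I * (creation P * annihilation Q)) D D =
      0 := by
  have hIu : annihilation I *ᵥ (annihilation Q *ᵥ Pi.single D (1 : ℂ)) = 0 := by
    rw [mulVec_mulVec, ← one_mul (annihilation I),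
      mul_annihilation_annihilation_mulVec_single_of_not_mem 1 Q hI]
  have hJu : annihilation J *ᵥ (annihilation Q *ᵥ Pi.single D (1 : ℂ)) = 0 := by
    rw [mulVec_mulVec, ← one_mul (annihilation J),
      mul_annihilation_annihilation_mulVec_single_of_not_mem 1 Q hJ]
  rw [apply_eq_mulVec_single (creation K * creation L * annihilation J * annihilation I * _) D D,
    show creation K * creation L * annihilation J * annihilation I * (creation P * annihilation Q) =
      creation K * (creation L * (annihilation J * (annihilation I * (creation P * annihilation Q))))
      by simp only [mul_assoc],
    ← mulVec_mulVec, ← mulVec_mulVec, ← mulVec_mulVec, ← mulVec_mulVec, ← mulVec_mulVec,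
    annihilation_mulVec_creation_mulVec, hIu, mulVec_zero, sub_zero, mulVec_smul, hJu, smul_zero,
    mulVec_zero, mulVec_zero, Pi.zero_apply]

/-- `⟨D| a†_K a†_L a_J a_I (a†_P a†_R a_S a_Q) |D⟩ = (δ_{IP}δ_{JR} − δ_{IR}δ_{JP}) ⟨D| a†_K a†_L a_S a_Q |D⟩`
for `I, J` empty in `|D⟩` (the double contraction; towards (1.4.24); helper). [folklore] -/
private theorem double_twoString_apply (hI : I ∉ D) (hJ : J ∉ D) (K L P Q R S : ι) :
    (creation K * creation L * annihilation J * annihilation I *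
        (creation P * creation R * annihilation S * annihilation Q)) D D =
      ((if I = P then (1 : ℂ) else 0) * (if J = R then (1 : ℂ) else 0) -
          (if I = R then (1 : ℂ) else 0) * (if J = P then (1 : ℂ) else 0)) *
        (creation K * creation L * annihilation S * annihilation Q) D D := by
  have hIu : annihilation I *ᵥ ((annihilation S * annihilation Q) *ᵥ Pi.single D (1 : ℂ)) = 0 := by
    rw [mulVec_mulVec, ← one_mul (annihilation I), ← mul_assoc,
      mul_annihilation_annihilation_annihilation_mulVec_single_of_not_mem 1 S Q hI]
  have hJu : annihilation J *ᵥ ((annihilation S * annihilation Q) *ᵥ Pi.single D (1 : ℂ)) = 0 := by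
    rw [mulVec_mulVec, ← one_mul (annihilation J), ← mul_assoc,
      mul_annihilation_annihilation_annihilation_mulVec_single_of_not_mem 1 S Q hJ]
  rw [apply_eq_mulVec_single (creation K * creation L * annihilation J * annihilation I * _) D D,
    show creation K * creation L * annihilation J * annihilation I *
        (creation P * creation R * annihilation S * annihilation Q) =
      creation K * (creation L * (annihilation J * (annihilation I * (creation P * (creation R *
        (annihilation S * annihilation Q)))))) by simp only [mul_assoc],
    ← mulVec_mulVec, ← mulVec_mulVec, ← mulVec_mulVec, ← mulVec_mulVec, ← mulVec_mulVec,
    ← mulVec_mulVec, annihilation_annihilation_mulVec_creation_creation_of_kills hIu hJu, mulVec_smul,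
    mulVec_smul, Pi.smul_apply, smul_eq_mul]
  simp only [mulVec_mulVec, ← mul_assoc, ← apply_eq_mulVec_single]

end Double

/-! ### (1.4.7) and (1.4.25): ON vectors differing in too many occupation numbers -/

/-- Support of `a†_P a_Q |J⟩`: a nonzero component at `|I⟩` forces `Q` occupied in `|J⟩`, `P` empty
in `|J ∖ Q⟩` and `|I⟩ = |J ∖ Q ∪ P⟩` (helper for (1.4.7)). [folklore] -/
private theorem creation_mul_annihilation_mulVec_single_apply_ne_zero {P Q : ι} {I J : Finset ι}
    (h : ((creation P * annihilation Q) *ᵥ Pi.single J (1 : ℂ)) I ≠ 0) :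
    Q ∈ J ∧ P ∉ J.erase Q ∧ I = insert P (J.erase Q) := by
  rw [← mulVec_mulVec, annihilation_mulVec_single] at h
  by_cases hQ : Q ∈ J
  · rw [if_pos hQ, mulVec_smul, FermionOperatorsProofs.creation_mulVec_single] at h
    by_cases hP : P ∈ J.erase Q
    · rw [if_pos hP, smul_zero, Pi.zero_apply] at h
      exact absurd rfl h
    · rw [if_neg hP, smul_smul, Pi.smul_apply, smul_eq_mul] at h
      by_cases hI : I = insert P (J.erase Q)
      · exact ⟨hQ, hP, hI⟩
      · rw [Pi.single_eq_of_ne hI, mul_zero] at h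
        exact absurd rfl h
  · rw [if_neg hQ, mulVec_zero, Pi.zero_apply] at h
    exact absurd rfl h

/-- Support of `a†_P a†_R a_S a_Q |J⟩` (helper for (1.4.25)). [folklore] -/
private theorem twoElectronString_mulVec_single_apply_ne_zero {P Q R S : ι} {I J : Finset ι}
    (h : ((creation P * creation R * annihilation S * annihilation Q) *ᵥ Pi.single J (1 : ℂ)) I ≠ 0) :
    Q ∈ J ∧ S ∈ J.erase Q ∧ R ∉ (J.erase Q).erase S ∧ P ∉ insert R ((J.erase Q).erase S) ∧
      I = insert P (insert R ((J.erase Q).erase S)) := by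
  rw [← mulVec_mulVec, annihilation_mulVec_single] at h
  by_cases hQ : Q ∈ J
  swap
  · rw [if_neg hQ, mulVec_zero, Pi.zero_apply] at h
    exact absurd rfl h
  rw [if_pos hQ, mulVec_smul, ← mulVec_mulVec, annihilation_mulVec_single] at h
  by_cases hS : S ∈ J.erase Q
  swap
  · rw [if_neg hS, mulVec_zero, smul_zero, Pi.zero_apply] at h
    exact absurd rfl h
  rw [if_pos hS, mulVec_smul, ← mulVec_mulVec, FermionOperatorsProofs.creation_mulVec_single] at h
  by_cases hR : R ∈ (J.erase Q).erase S
  · rw [if_pos hR, mulVec_zero, smul_zero, smul_zero, Pi.zero_apply] at h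
    exact absurd rfl h
  rw [if_neg hR, mulVec_smul, FermionOperatorsProofs.creation_mulVec_single] at h
  by_cases hP : P ∈ insert R ((J.erase Q).erase S)
  · rw [if_pos hP, smul_zero, smul_zero, smul_zero, Pi.zero_apply] at h
    exact absurd rfl h
  rw [if_neg hP, smul_smul, smul_smul, smul_smul, Pi.smul_apply, smul_eq_mul] at h
  by_cases hI : I = insert P (insert R ((J.erase Q).erase S))
  · exact ⟨hQ, hS, hR, hP, hI⟩
  · rw [Pi.single_eq_of_ne hI, mul_zero] at h
    exact absurd rfl h

/-- **One-electron operator, ON vectors differing in more than one pair** — Helgaker–Jørgensen–Olsen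
(2000) eq. (1.4.7): `⟨k₂| f̂ |k₁⟩ = 0` unless `|k₂⟩` and `|k₁⟩` have the same number of electrons and
differ in at most one pair of occupation numbers (`#(k₁ ∖ k₂) ≤ 1`).
[cite: HelgakerJorgensenOlsen2000, eq. (1.4.7)] -/
theorem dGamma_apply_eq_zero_of (f : Matrix ι ι ℂ) {I J : Finset ι}
    (h : ¬(I.card = J.card ∧ (J \ I).card ≤ 1)) : dGamma f I J = 0 := by
  rw [dGamma_apply]
  refine Finset.sum_eq_zero fun P _ => Finset.sum_eq_zero fun Q _ => ?_
  by_cases hz : (creation P * annihilation Q) I J = 0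
  · rw [hz, mul_zero]
  exfalso
  rw [apply_eq_mulVec_single (creation P * annihilation Q) I J] at hz
  obtain ⟨hQ, hP, rfl⟩ := creation_mul_annihilation_mulVec_single_apply_ne_zero hz
  apply h
  refine ⟨by rw [card_insert_of_notMem hP, card_erase_add_one hQ], ?_⟩
  calc (J \ insert P (J.erase Q)).card ≤ ({Q} : Finset ι).card := by
        refine card_le_card fun x hx => ?_
        rw [mem_sdiff, mem_insert, not_or, mem_erase, not_and_or, not_not] at hx
        rw [mem_singleton]
        rcases hx.2.2 with hxQ | hxJ
        · exact hxQ
        · exact absurd hx.1 hxJ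
    _ = 1 := card_singleton Q

/-- **Two-electron operator, ON vectors differing in more than two pairs** — Helgaker–Jørgensen–Olsen
(2000) eq. (1.4.25): `⟨k₂| ĝ |k₁⟩ = 0` unless `|k₂⟩` and `|k₁⟩` have the same number of electrons
and differ in at most two pairs of occupation numbers (`#(k₁ ∖ k₂) ≤ 2`).
[cite: HelgakerJorgensenOlsen2000, eq. (1.4.25)] -/
theorem twoElectronOp_apply_eq_zero_of (g : ι → ι → ι → ι → ℂ) {I J : Finset ι}
    (h : ¬(I.card = J.card ∧ (J \ I).card ≤ 2)) : twoElectronOp g I J = 0 := by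
  rw [twoElectronOp_apply]
  refine mul_eq_zero_of_right _ (Finset.sum_eq_zero fun P _ => Finset.sum_eq_zero fun Q _ =>
    Finset.sum_eq_zero fun R _ => Finset.sum_eq_zero fun S _ => ?_)
  by_cases hz : (creation P * creation R * annihilation S * annihilation Q) I J = 0
  · rw [hz, mul_zero]
  exfalso
  rw [apply_eq_mulVec_single (creation P * creation R * annihilation S * annihilation Q) I J] at hz
  obtain ⟨hQ, hS, hR, hP, rfl⟩ := twoElectronString_mulVec_single_apply_ne_zero hz
  apply h
  have hc : (J.erase Q).card + 1 = J.card := card_erase_add_one hQ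
  have hc' : ((J.erase Q).erase S).card + 1 = (J.erase Q).card := card_erase_add_one hS
  refine ⟨by rw [card_insert_of_notMem hP, card_insert_of_notMem hR]; omega, ?_⟩
  calc (J \ insert P (insert R ((J.erase Q).erase S))).card ≤ ({Q, S} : Finset ι).card := by
        refine card_le_card fun x hx => ?_
        rw [mem_sdiff, mem_insert, not_or, mem_insert, not_or, mem_erase, not_and_or, not_not,
          mem_erase, not_and_or, not_not] at hx
        rw [mem_insert, mem_singleton]
        rcases hx.2.2.2 with hxS | hxQ | hxJ
        · exact Or.inr hxS
        · exact Or.inl hxQ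
        · exact absurd hx.1 hxJ
    _ ≤ 2 := card_le_two

end SpinOrbital

end Literature.MathematicalPhysics.QuantumChemistry
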